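import Summits.Parity.GeneralizedHardyLittlewood.Theorems.GoldbachHeathBrownDispersionHeathBrownMorozUniformRangeKernelReducedOfClassLemmas
import Summits.Parity.GeneralizedHardyLittlewood.Theorems.GoldbachHeathBrownDispersionHeathBrownMorozUniformH310
import Summits.Parity.GeneralizedHardyLittlewood.Theorems.GoldbachHeathBrownDispersionHeathBrownMorozUniformH39
import Literature.NumberTheory.Sieve.HeathBrownMorozClassLemma35
import HarnessLib

/-!
# Route `GoldbachHeathBrownDispersion` — crux child `RangeKernelReduced` (stmt-Parity-20702) PROVED

The by-name closing file of the split child `RangeKernelReduced` of the crux `HeathBrownMorozUniform`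
(stmt-Parity-19915) of route `route-Parity-GoldbachHeathBrownDispersion` (Line C, FRONTIER formalisation rung F-P1b):
Heath-Brown–Moroz 2004, Theorem 2 for `x³ + 2y³`, per reduced admissible class `(a, b) mod d`, in the
ALL-LARGE-`c` form — for every `c ≥ c₁(d, a, b)` the class box count with `η = (log X)^{-c}` is
`w(d)·σ₀η²X²/(3 log X)·(1 + o(1))`.

Proof: `rangeKernelReduced_of_classLemmas` (p564021; the class η-band bookkeeping + frame transfer of the landed
campaign) applied to the three class lemmas, all THEOREMS now: `h35` = the landed class Lemma 3.5 `CubicSieve.class_lemma_3_5` (p555871, by name), `h39` = `class_h39` (class Lemma 3.9, `…H39`, p565223: S4a + S3 + S4b + EQ39 + the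
parent's Lemma 3.9), `h310` = `class_h310` (`…H310`, p569449: class Lemma 3.10 with (3.14) up to `d·Q₁`, from E3 + E4 + the
twisted dispersion bound E5 `stub_twistedSsum` of the `CubicSieve.Twisted` port of Heath-Brown §§11–13).

**Honesty.** This is the formalisation of a 2004 theorem (one crux of a FRONTIER rung); it says nothing about the
binary Goldbach problem.

References: [cite: HeathBrownMoroz2004, Theorem 2]; [cite: HeathBrownActa2001, Theorem 1, Lemmas 3.5, 3.9, 3.10].
-/

namespace Summit.Parity.GeneralizedHardyLittlewood.Theorems

open Summit.Parity.GeneralizedHardyLittlewood.Theorems.GoldbachHeathBrownDispersionHeathBrownMorozUniform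

/-- **`RangeKernelReduced` holds** (route `GoldbachHeathBrownDispersion`, crux child stmt-Parity-20702): for every
reduced admissible class `(a, b) mod d` there is `c₁ > 0` such that for every `c ≥ c₁`,
`residueClassPrimeCount X (log X)^{-c} d a b = w(d)·mainTerm c σ₀ X·(1 + o(1))`, `σ₀` the limit of the singular
product — Heath-Brown–Moroz 2004, Theorem 2 for `x³ + 2y³` (all-large-`c` form), from the three class lemmas
`class_lemma_3_5`, `class_h39`, `class_h310` by `rangeKernelReduced_of_classLemmas`.
[cite: HeathBrownMoroz2004, Theorem 2] -/
theorem goldbachHeathBrownDispersion_rangeKernelReduced_proof :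
    Summit.Parity.GeneralizedHardyLittlewood.Theses.GoldbachHeathBrownDispersion.RangeKernelReduced :=
  rangeKernelReduced_of_classLemmas
    (fun _d _a _b hd ha hb hadm σ₀ hσ ϖ hϖ0 hϖ5 =>
      Literature.NumberTheory.Sieve.CubicSieve.class_lemma_3_5 hd ha hb hadm σ₀ hσ ϖ hϖ0 hϖ5)
    class_h39 class_h310

end Summit.Parity.GeneralizedHardyLittlewood.Theorems
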